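import Summits.HodgeConjecture.HodgeConjecture.Theses.PadicSemiregularLift
import Literature.AlgebraicGeometry.HodgeTheory.SemiregularityMap

/-!
# `SemiregularSeedsOnAnchors` (stmt-HodgeConjecture-13941) · Negative · transport, 2-rigidity, the ℚ(i) parity obstruction

Negative-side knowledge for the informal crux `PadicSemiregularLift.SemiregularSeedsOnAnchors`, cycle 2
of the standing disprover (refuter-cdisprove-stmt-HodgeConjecture-13941-g2-0, 2026-08-16), extracted from
`Cruxes/SemiregularSeedsOnAnchors/Disproof.lean` §G1–§G4 so that ideators, planners and provers can import
them (companion of `Negative/SemiregularityCarrier.lean`, cycle 1). Unconditional theorems; none asserts a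
Theses declaration:

* `isSemiregular_transport`, `isSemiregular_iff_of_intertwiner` — semiregularity over the σ-carrier
  `AtiyahTraceAlgebra` is transported along any intertwiner of the σ-data (the carrier form of derived
  invariance, Perry arXiv:2604.00511 Rem. 2.3); with Mukai's IT₀ + Fourier–Mukai this makes the COHERENT
  and the LOCALLY FREE variants of the crux equivalent at principally polarised abelian anchors
  (Disproof §G1) — a forced-kernel kill must kill both at once;
* `isSemiregular_of_finrank_ext_eq_one`, `isSemiregular_of_finrank_ext_eq_one_of_trace` — an object with
  `dim Ext²(E,E) = 1` on which one component `σ_k` (e.g. the trace) is non-zero is semiregular: 2-rigid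
  sheaves are seeds for their own `ch₂` (Disproof §G2, used at K3^{[2]} anchors, §G3);
* `finrank_range_le_of_le_finrank_ker` + `hilbSquare_numbers` — the budget collapse `ext² ≤ 23 − 20 = 3`
  at very general polarised K3^{[2]} anchors;
* `secant_discriminants`, `qi_data_arithmetic`, `F2_parity_obstruction`, `F2_parity_obstruction_swapped`
  — the exact arithmetic of the secant audit (kit job j009174) and the `𝔽₂`-obstruction that kills the
  untwisting congruence (F2) of the even-rank `ℚ(i)` avatar of card rank-one-secant-square-seeds:
  `c₁(𝓔) ≢ λ·Ξ_P (mod 2)` for every `λ`, so no line-bundle / det twist of the rank `∓2` secant sheaf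
  satisfies the degree-1 Hodge condition (Disproof §G4 (iii)).
-/

noncomputable section

namespace Summit.HodgeConjecture.HodgeConjecture.Theorems.SemiregularSeedsOnAnchors.Negative

open Literature.AlgebraicGeometry.HodgeTheory

universe u v

section Transport

variable {K : Type u} [Field K] (A B : AtiyahTraceAlgebra.{u, v} K)

/-- **Transport of semiregularity along an intertwiner.** If `e : Ext²_A ≃ Ext²_B` and injective
`g_k : H^{k+2}(Ω^k)_A → H^{k+2}(Ω^k)_B` intertwine the semiregularity maps (`σ^B_k ∘ e = g_k ∘ σ^A_k`),
then `A` semiregular ⇒ `B` semiregular. Geometric instance: a Fourier–Mukai equivalence `Φ` with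
`e = Φ_*` on `Ext²` and `g_k` the induced isomorphisms of Hochschild/Hodge targets (HKR for
`p > dim`). [folklore; cite: Perry2026Semiregularity, Rem. 2.3 and Def. 2.4] -/
theorem isSemiregular_transport (e : A.Ext 2 0 ≃ₗ[K] B.Ext 2 0)
    (g : ∀ k, A.Coh (k + 2) k →ₗ[K] B.Coh (k + 2) k) (hg : ∀ k, Function.Injective (g k))
    (hcomm : ∀ k x, B.semiregularityComponent k (e x) = g k (A.semiregularityComponent k x))
    (hA : A.IsSemiregular) : B.IsSemiregular := by
  rw [AtiyahTraceAlgebra.isSemiregular_iff] at hA ⊢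
  intro y hy
  obtain ⟨x, rfl⟩ := e.surjective y
  have hx : x = 0 := hA x fun k => hg k (by rw [← hcomm, hy k, map_zero])
  rw [hx, map_zero]

/-- **Derived invariance, carrier form.** Along an intertwiner that is an isomorphism on `Ext²` and on
every target, semiregularity is invariant (the shape in which `ext²` and `rank ev` are derived
invariants). [folklore; cite: Perry2026Semiregularity, Rem. 2.3] -/
theorem isSemiregular_iff_of_intertwiner (e : A.Ext 2 0 ≃ₗ[K] B.Ext 2 0)
    (g : ∀ k, A.Coh (k + 2) k ≃ₗ[K] B.Coh (k + 2) k)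
    (hcomm : ∀ k x, B.semiregularityComponent k (e x) = g k (A.semiregularityComponent k x)) :
    A.IsSemiregular ↔ B.IsSemiregular := by
  refine ⟨isSemiregular_transport A B e (fun k => (g k : A.Coh (k + 2) k →ₗ[K] B.Coh (k + 2) k))
    (fun k => (g k).injective) hcomm, ?_⟩
  refine isSemiregular_transport B A e.symm
    (fun k => ((g k).symm : B.Coh (k + 2) k →ₗ[K] A.Coh (k + 2) k)) (fun k => (g k).symm.injective) ?_
  intro k y
  obtain ⟨x, rfl⟩ := e.surjective y
  rw [LinearEquiv.symm_apply_apply]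
  apply (g k).injective
  rw [hcomm k x]
  simp

end Transport

section TraceRigid

variable {K : Type u} [Field K] (A : AtiyahTraceAlgebra.{u, v} K)

/-- **2-rigid ⇒ semiregular.** `dim Ext²(E,E) = 1` and `σ_k ≠ 0` for some `k` imply semiregularity
(no hypothesis on the other components; compare `cubicFourfold_isSemiregular_iff`). [folklore] -/
theorem isSemiregular_of_finrank_ext_eq_one [FiniteDimensional K (A.Ext 2 0)]
    (h1 : Module.finrank K (A.Ext 2 0) = 1) (k : ℕ) (hk : A.semiregularityComponent k ≠ 0) :
    A.IsSemiregular := by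
  rw [AtiyahTraceAlgebra.isSemiregular_iff]
  intro x hx
  by_contra hx0
  apply hk
  ext y
  obtain ⟨c, rfl⟩ := (finrank_eq_one_iff_of_nonzero' x hx0).1 h1 y
  rw [map_smul, hx k, smul_zero]
  rfl

/-- **`Ext² = H²(𝒪)·id ⇒ semiregular.`** With `dim Ext²(E,E) = 1`, non-vanishing of the trace
`Tr : Ext²(E,E) → H²(X,𝒪_X)` (`σ₀ = Tr`; e.g. `Tr(η·id_E) = rk(E)·η` with `p ∤ rk E`) suffices: line
bundles, ℙⁿ-objects on hyper-Kähler `2n`-folds, O'Grady's rigid modular bundles (`H^*(End₀) = 0`) are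
seeds for their own `ch₂`. [folklore; cite: BuchweitzFlenner2003, §1 (σ₀ = Tr, Artamkin–Mukai)] -/
theorem isSemiregular_of_finrank_ext_eq_one_of_trace [FiniteDimensional K (A.Ext 2 0)]
    (h1 : Module.finrank K (A.Ext 2 0) = 1) (htr : A.trace 2 0 ≠ 0) : A.IsSemiregular := by
  refine isSemiregular_of_finrank_ext_eq_one A h1 0 ?_
  intro h0
  apply htr
  ext x
  rw [← AtiyahTraceAlgebra.semiregularityComponent_zero_apply, h0]

end TraceRigid

section HilbertSquare

variable {K : Type u} [Field K] {H V : Type v} [AddCommGroup H] [Module K H] [AddCommGroup V]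
  [Module K V]

/-- **Budget collapse** (rank–nullity): if `ev : HT²(X) → Ext²(E,E)` kills a `d`-dimensional subspace
of the `n`-dimensional `HT²`, then `rank ev ≤ n − d`. With `σ = evᵗ` a semiregular `E` has
`ext² = rank ev`; at a very general polarised K3^{[2]}-anchor `ev` kills `ann(h) ⊂ H¹(T_X)` (`c₂(X)`
stays Hodge on the whole base), `n = 23`, `d = 20`: every seed there has `ext²(E,E) ≤ 3`. [folklore] -/
theorem finrank_range_le_of_le_finrank_ker [FiniteDimensional K H] (ev : H →ₗ[K] V) {n d : ℕ}
    (hn : Module.finrank K H = n) (hd : d ≤ Module.finrank K (LinearMap.ker ev)) :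
    Module.finrank K (LinearMap.range ev) ≤ n - d := by
  have h := LinearMap.finrank_range_add_finrank_ker ev
  omega

/-- Numbers for `X` of K3^{[2]} type: `τ = h^{0,2}+h^{1,3}+h^{2,4} = 1+21+1 = 23 = dim HT²(X)`;
`b₄ = dim Sym²H² = C(24,2) = 276` (so `H⁴ = Sym²H²` is Lefschetz on a supersingular Hilbert square,
`ρ = 23`); `χ(𝒪_X) = td₄ = (3c₂² − c₄)/720 = (3·828 − 324)/720 = 3` (a rigid simple bundle has
`ext² = χ(E,E) − 2`); budget `23 − 20 = 3`; for a Lagrangian plane `P`: `∫_P c₂(X) = 3 + 3 − 9 = −3`,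
`ch₄(𝒪_P) = 1 + 3/12 = 5/4 ≠ 0`. [folklore: Ellingsrud–Strømme / Göttsche numbers of K3^{[2]}] -/
theorem hilbSquare_numbers :
    1 + 21 + 1 = 23 ∧ Nat.choose 24 2 = 276 ∧ (3 * 828 - 324) / 720 = 3 ∧ 23 - 20 = 3 ∧
      (3 : ℤ) + 3 - 9 = -3 ∧ (1 : ℚ) + 3 / 12 = 5 / 4 := by
  refine ⟨by decide, by decide, by decide, by decide, by norm_num, by norm_num⟩

end HilbertSquare

section SecantAudit

/-- Gram discriminants of the secant planes (Mukai pairing `⟨(r,c,s),(r',c',s')⟩ = cc' − rs' − r's`):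
`⟨v(𝓘_x), v(L𝓘_y)⟩ = ⟨(1,0,−1),(1,ℓ,0)⟩`: `[[2,1],[1,2]]`, disc `3` (`K = ℚ(√−3)`); the `ℚ(i)` data
`v₁ = (1,A,5)`, `v₂ = (1,B,0)` (`A² = 12`, `B² = 4`, `A·B = 7`): `[[2,2],[2,4]]`, disc `4`; the same data
with `v₁^∨` put into the plane: `[[2,−12],[−12,4]]`, disc `−136 < 0` (indefinite: the KERNEL of the secant
object carries `v₁^∨`, the PLANE is `⟨v₁,v₂⟩`); the rank-0 orthogonal pair `⟨v(𝓘_x), v(B𝓘_y)⟩`: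
`diag(2,2)`, disc `4`. [computed: kit job j009174] -/
theorem secant_discriminants :
    (2 : ℤ) * 2 - 1 * 1 = 3 ∧ (2 : ℤ) * 4 - 2 * 2 = 4 ∧ (2 : ℤ) * 4 - (-12) * (-12) = -136 ∧
      (2 : ℤ) * 2 - 0 * 0 = 4 := by
  norm_num

/-- The `ℚ(i)` data of the card: `A = 3f₁+2f₂`, `B = 2f₁+f₂` on the hyperbolic plane `⟨f₁,f₂⟩`
(`fᵢ² = 0`, `f₁f₂ = 1`): `A² = 12`, `B² = 4`, `A·B = 7`; `v(𝓘_y ⊗ A) = (1, A, A²/2 − 1) = (1,A,5)`,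
`v² = A² − 2·5 = 2`; `v(𝓘_{x,x+τ} ⊗ B) = (1, B, B²/2 − 2) = (1,B,0)`; pairing `A·B − 0 − 5 = 2`; rank of
the Orlov image `∫ v₁^∨ v₂ = −(A·B) + 5 = −2`; `χ` of the images `2·2 = 4` (`ℚ(√−3)`), `2·4 = 8`
(`ℚ(i)`, before descent). [computed: kit job j009174] -/
theorem qi_data_arithmetic :
    2 * (3 * 2) = 12 ∧ 2 * (2 * 1) = 4 ∧ 3 * 1 + 2 * 2 = 7 ∧ (12 : ℤ) / 2 - 1 = 5 ∧
      (12 : ℤ) - 2 * 5 = 2 ∧ (4 : ℤ) / 2 - 2 = 0 ∧ (7 : ℤ) - 0 - 5 = 2 ∧ -(7 : ℤ) + 5 = -2 ∧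
      (2 : ℤ) * 2 = 4 ∧ (2 : ℤ) * 4 = 8 := by
  norm_num

/-- **The untwisting congruence (F2) of the even-rank `ℚ(i)` secant avatar fails.** For the rank `−2`
Orlov image `𝓔 = Ψ((𝓘_y A)^∨ ⊠ 𝓘_{x,x+τ}B)` on `X = S × Ŝ` (`A = 3f₁+2f₂`, `B = 2f₁+f₂`), reduce
`c₁(𝓔) = 10f₁ + 5f₂ − 2a₁a₁^∨ − 2b₁b₁^∨ + a₁^∨b₁^∨ − a₂a₂^∨ − b₂b₂^∨ + a₂^∨b₂^∨` and the primitive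
polarisation `Ξ_P = 10f₁ + 5f₂ − 3a₁a₁^∨ − 3b₁b₁^∨ + a₁^∨b₁^∨ − 2a₂a₂^∨ − 2b₂b₂^∨ + a₂^∨b₂^∨` modulo 2
on the seven coordinates of `H²(X,𝔽₂) = Λ²H¹(X,𝔽₂)` where either is odd, in the order
`[f₂, a₁a₁^∨, b₁b₁^∨, a₂a₂^∨, b₂b₂^∨, a₁^∨b₁^∨, a₂^∨b₂^∨]` (all other coordinates of both are even):
`c₁ ↦ (1,0,0,1,1,1,1)`, `Ξ_P ↦ (1,1,1,0,0,1,1)`. No `λ ∈ 𝔽₂` has `c₁(𝓔) ≡ λ·Ξ_P (mod 2)`. Since odd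
multiples `u·c₁` (det-twists `𝓔 ⊗ det^k`, `u = 1 + rk`) reduce to `c₁ mod 2` and line-bundle twists of
the rank `∓2` sheaf move `c₁` by `2NS`, NO twist `𝓔 ⊗ M` has `c₁ ∝ Ξ_P`: the degree-1 Hodge
condition fails at every very general point of the `(η_P,Ξ_P)` Weil disc — upstairs on `S × Ŝ`, hence
(pull-back of an even class is even; no prime-to-`p` torsion in `coker sp`, Disproof D4) on the anchor
`X_k` and on its quotient `X_k/Ḡ`. [computed: kit job j009174, part B] -/
theorem F2_parity_obstruction :
    ∀ l : ZMod 2, (![1, 0, 0, 1, 1, 1, 1] : Fin 7 → ZMod 2) ≠ l • (![1, 1, 1, 0, 0, 1, 1]) := by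
  decide

/-- The same obstruction for the `f₁ ↔ f₂`-swapped data (`A = 2f₁+3f₂`, `B = f₁+2f₂`): the odd supports
are exchanged between the two index blocks, the mismatch persists (the role-swapped and the
`(A,B) ↦ (−A,−B)` variants have literally the supports of `F2_parity_obstruction`).
[computed: kit job j009174, parts B', B'', B'''] -/
theorem F2_parity_obstruction_swapped :
    ∀ l : ZMod 2, (![1, 1, 1, 0, 0, 1, 1] : Fin 7 → ZMod 2) ≠ l • (![1, 0, 0, 1, 1, 1, 1]) := by
  decide

end SecantAudit

end Summit.HodgeConjecture.HodgeConjecture.Theorems.SemiregularSeedsOnAnchors.Negative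

end
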